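import Summits.QuantumFields.YangMills.Theorems.SwapVirialDeficitSectorLaplaceMbDensityDetFol
import Summits.QuantumFields.YangMills.Theorems.SwapVirialDeficitBlowUpGnomonicApexSoftLine
import Mathlib.MeasureTheory.Measure.Lebesgue.EqHaar
import HarnessLib

/-!
# Route `SwapVirialDeficit` (YangMills): THE SHELL-SIDE FLOOR OF THE MORSE–BOTT DENSITY WITH ONE SOFT PAIR — `𝔪(angUnit θ,ε,p) ≳ θ⁻¹·(det A_F)^{−1/2}`
# (cell ym-idea-1, skeleton ➎, `stub_core_tip`: brick `mbDensity_ge_softCeil` of w2 g60's memo3 §6, SHELL side of the Hessian sandwich;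
# free-hands support of ⟨stmt-QuantumFields-24197⟩ `SwapVirialDeficit.SwapGluedStiffness`)

✓`mbDensity_ge_detFol` floors `𝔪 = ρ(η₀)(2π)^{−α}∫_{V_L}e^{−½Q}` by bounding the seven leader-transverse letters `(u,v,z)` ISOTROPICALLY (`Q ≤ Λ‖·‖²`, `Λ = 20400L⁴`),
followers exact.  At the hub `angUnit θ` the `(u,v)` block has ONE SOFT PAIR: on the soft plane `S(p) = {(p₁e, p₂e)}` the fibre form is `≤ 122689728·L⁴·θ·‖·‖²`
(✓`fibQ_angUnit_softDir_le`).  Split `y = y_soft + y_rest`, `y_soft = (p₁e, p₂e, 0, 0)`, `e = σ/|p|`, `σ = (p₁u + p₂v)/|p|`, `y_rest = ((p₂η, −p₁η)/|p|, z, 0)`,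
`η = (p₂u − p₁v)/|p|` (psd Peter–Paul `Q(y) ≤ 2Q(y_soft) + 2Q(y_rest)`); the leader factor becomes the anisotropic Gaussian `∫ e^{−(1+d)(Cθ|σ|² + Λ|η|² + Λ|z|²)}` in the
ROTATED letters `(σ, η)`; the reflection `(u,v) ↦ (σ,η)` is a linear involution, so `|det| = 1` and it preserves Lebesgue measure (✓`Measure.map_linearMap_addHaar_eq_smul_addHaar`,
no matrix): `softRot_softRot`, `measurePreserving_softRot`, `lintegral_exp_neg_softRot` (§1); ★★★ `mbDensity_ge_softCeil` (§2) —
`ρ(gnoBase p)·(2(1+d)·122689728L⁴θ)^{−1}·(2(1+d)·20400L⁴)^{−5/2}·(1+1/d)^{−d/2}/√det A_F(gnoBase p) ≤ 𝔪(angUnit θ, ε, p)` for `0 < θ ≤ 1`, good signs, `p ≠ 0`;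
`mbDensity_ge_softCeil'` (constant `e^{−1/2}`).  The TIP twin `mbDensity_le_floorDet` is w2 g61's; comparability and assembly follow (memo3 §§3, 5).

HONEST LABEL: measure ∕ linear-algebra plumbing at fixed `L`; `stub_core_tip`, `stub_end_gaussCore`, ⟨24197⟩ ∕ ⟨24194⟩ OPEN; own crux ⟨22884⟩ `LargeFieldMassRefinementTail` OPEN
(blocked-on ⟨19935⟩); the Yang–Mills mass gap is NOT proved; no summit is proved by a line.  THEOREMS ONLY (0 `def`, 0 `sorry`), standard axioms, no instances
(the product Haar instance is a local `haveI`).  Width seat ym-line-sfw-p2-w3 g68 (cell ym-idea-1, free hands), `--supports stmt-QuantumFields-24197`.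
References: [cite: Luscher1983, §2]; [cite: Breitung1994, Lemma 26]; [folklore].
-/

set_option autoImplicit false
set_option synthInstance.maxSize 1024

noncomputable section

open MeasureTheory Quaternion Set Module
open scoped Quaternion BigOperators ENNReal InnerProductSpace
open Literature.MathematicalPhysics.QuantumLattice
open Literature.MathematicalPhysics.QuantumFieldTheory hiding SU2

namespace Summit.QuantumFields.YangMills.Theorems.SwapVirialDeficit.SectorLaplace

open Summit.QuantumFields.YangMills.Theorems.FemtoTransferGap
open Summit.QuantumFields.YangMills.Theorems.FemtoTransferGap.TT
open Summit.QuantumFields.YangMills.Theorems.VirialFluxGap.RingDeficit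
open Summit.QuantumFields.YangMills.Theorems.SwapVirialDeficit.SwapRing
open Summit.QuantumFields.YangMills.Theorems.SwapVirialDeficit.BlowUpRing
open Summit.QuantumFields.YangMills.Theorems.SwapVirialDeficit.Gnomonic (normSq3 normSq3_nonneg)
open Summit.QuantumFields.YangMills.Theorems.QuantitativeLaplace (integral_exp_neg_mul_half_inner integrable_exp_neg_mul_half_inner inner_pos_of_coercive)
open Literature.Analysis.Asymptotics (det_pos_of_inner_pos)

variable {L : ℕ} [NeZero L]

/-! ## §1 The rotated letters of the `(u,v)` block: an involution, measure preserving; its anisotropic Gaussian -/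

omit [NeZero L] in
/-- The `(u,v) ↦ (c•u + s•v, s•u − c•v)` reflection of the two free-leader transverse letters (`c² + s² = 1`) is an involution. [folklore] -/
theorem softRot_softRot {c s : ℝ} (h : c ^ 2 + s ^ 2 = 1) (q : (Fin 2 → ℝ) × (Fin 2 → ℝ)) :
    (c • (c • q.1 + s • q.2) + s • (s • q.1 - c • q.2), s • (c • q.1 + s • q.2) - c • (s • q.1 - c • q.2)) = q := by
  obtain ⟨u, v⟩ := q
  refine Prod.ext (funext fun i => ?_) (funext fun i => ?_) <;> simp only [Pi.add_apply, Pi.smul_apply, Pi.sub_apply, smul_eq_mul]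
  · linear_combination (u i) * h
  · linear_combination (v i) * h

omit [NeZero L] in
/-- The reflection `(u,v) ↦ (c•u + s•v, s•u − c•v)` (`c² + s² = 1`) preserves Lebesgue measure on `ℝ² × ℝ²`: it is a linear involution, so `|det| = 1`
(✓`Measure.map_linearMap_addHaar_eq_smul_addHaar`, no matrix computation). [folklore] -/
theorem measurePreserving_softRot {c s : ℝ} (h : c ^ 2 + s ^ 2 = 1) :
    MeasurePreserving (fun q : (Fin 2 → ℝ) × (Fin 2 → ℝ) => (c • q.1 + s • q.2, s • q.1 - c • q.2)) volume volume := by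
  set T : ((Fin 2 → ℝ) × (Fin 2 → ℝ)) →ₗ[ℝ] ((Fin 2 → ℝ) × (Fin 2 → ℝ)) :=
    (c • LinearMap.fst ℝ (Fin 2 → ℝ) (Fin 2 → ℝ) + s • LinearMap.snd ℝ (Fin 2 → ℝ) (Fin 2 → ℝ)).prod
      (s • LinearMap.fst ℝ (Fin 2 → ℝ) (Fin 2 → ℝ) - c • LinearMap.snd ℝ (Fin 2 → ℝ) (Fin 2 → ℝ)) with hT
  have hTapp : ∀ q : (Fin 2 → ℝ) × (Fin 2 → ℝ), T q = (c • q.1 + s • q.2, s • q.1 - c • q.2) := fun q => rfl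
  have hfun : (fun q : (Fin 2 → ℝ) × (Fin 2 → ℝ) => (c • q.1 + s • q.2, s • q.1 - c • q.2)) = ⇑T := funext fun q => (hTapp q).symm
  have hTT : T ∘ₗ T = LinearMap.id := LinearMap.ext fun q => by
    rw [LinearMap.comp_apply, LinearMap.id_apply, hTapp, hTapp]; exact softRot_softRot h q
  have hdet : LinearMap.det T * LinearMap.det T = 1 := by
    rw [← LinearMap.det_comp, hTT, LinearMap.det_id]
  have hdet0 : LinearMap.det T ≠ 0 := fun h0 => by rw [h0, mul_zero] at hdet; exact zero_ne_one hdet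
  have habs : |(LinearMap.det T)⁻¹| = 1 := by
    have h1 : |LinearMap.det T| = 1 := by
      have hsq : |LinearMap.det T| ^ 2 = 1 := by rw [sq_abs, sq]; exact hdet
      nlinarith [abs_nonneg (LinearMap.det T)]
    rw [abs_inv, h1, inv_one]
  haveI : (volume : Measure ((Fin 2 → ℝ) × (Fin 2 → ℝ))).IsAddHaarMeasure := Measure.prod.instIsAddHaarMeasure _ _
  have hmap := Measure.map_linearMap_addHaar_eq_smul_addHaar (volume : Measure ((Fin 2 → ℝ) × (Fin 2 → ℝ))) hdet0
  rw [habs, ENNReal.ofReal_one, one_smul] at hmap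
  rw [hfun]
  exact ⟨T.continuous_of_finiteDimensional.measurable, hmap⟩

omit [NeZero L] in
/-- ★ The anisotropic four-letter Gaussian in rotated letters: `∫_{ℝ²×ℝ²} e^{−(a|c u + s v|² + b|s u − c v|²)} = (√(π/a))²·(√(π/b))²` (`c² + s² = 1`). [folklore] -/
theorem lintegral_exp_neg_softRot {c s : ℝ} (h : c ^ 2 + s ^ 2 = 1) {a b : ℝ} (ha : 0 < a) (hb : 0 < b) :
    ∫⁻ q : (Fin 2 → ℝ) × (Fin 2 → ℝ), ENNReal.ofReal (Real.exp (-(a * ∑ i, (c • q.1 + s • q.2) i ^ 2 + b * ∑ i, (s • q.1 - c • q.2) i ^ 2))) =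
      ENNReal.ofReal (Real.sqrt (Real.pi / a) ^ 2 * Real.sqrt (Real.pi / b) ^ 2) := by
  have hG : Measurable fun q : (Fin 2 → ℝ) × (Fin 2 → ℝ) => ENNReal.ofReal (Real.exp (-(a * ∑ i, q.1 i ^ 2 + b * ∑ i, q.2 i ^ 2))) := by
    refine ENNReal.measurable_ofReal.comp (Real.measurable_exp.comp (Measurable.neg (Measurable.add ?_ ?_)))
    · exact (Finset.measurable_sum _ fun i _ => ((measurable_pi_apply i).comp measurable_fst).pow_const 2).const_mul a
    · exact (Finset.measurable_sum _ fun i _ => ((measurable_pi_apply i).comp measurable_snd).pow_const 2).const_mul b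
  have hcomp := (measurePreserving_softRot h).lintegral_comp hG
  simp only at hcomp
  rw [hcomp]
  have hint : Integrable (fun q : (Fin 2 → ℝ) × (Fin 2 → ℝ) => Real.exp (-(a * ∑ i, q.1 i ^ 2)) * Real.exp (-(b * ∑ i, q.2 i ^ 2))) :=
    (integrable_exp_neg_mul_sumSq_pi 2 ha).mul_prod (integrable_exp_neg_mul_sumSq_pi 2 hb)
  have e : (fun q : (Fin 2 → ℝ) × (Fin 2 → ℝ) => ENNReal.ofReal (Real.exp (-(a * ∑ i, q.1 i ^ 2 + b * ∑ i, q.2 i ^ 2)))) =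
      fun q => ENNReal.ofReal (Real.exp (-(a * ∑ i, q.1 i ^ 2)) * Real.exp (-(b * ∑ i, q.2 i ^ 2))) := by
    funext q; rw [← Real.exp_add]; ring_nf
  rw [e, ← ofReal_integral_eq_lintegral_ofReal hint (ae_of_all _ fun q => by positivity)]
  congr 1
  rw [MeasureTheory.Measure.volume_eq_prod]
  rw [integral_prod_mul (fun u : Fin 2 → ℝ => Real.exp (-(a * ∑ i, u i ^ 2))) (fun v : Fin 2 → ℝ => Real.exp (-(b * ∑ i, v i ^ 2))),
    integral_exp_neg_mul_sumSq_pi 2, integral_exp_neg_mul_sumSq_pi 2]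

/-! ## §2 The floor with one soft pair -/

set_option maxHeartbeats 400000 in
/-- ★★★ **THE MORSE–BOTT DENSITY AT HUB ANGLE `θ` IS AT LEAST OF ORDER `1/θ` (one soft pair).**  Hub `angUnit θ` with `0 < θ ≤ 1`, good signs `ε`, base point
`p ≠ 0`; `A_F` a symmetric follower family with the form identity at the hub `angUnit θ` (✓`exists_gnoFolHessian`).  Then, with `d = dim V_F = 3|Fol L|`,
`C = 122689728L⁴`, `Λ = 20400L⁴`:
`gnoDensity(gnoBase p)·(2(1+d)Cθ)^{−1}·(2(1+d)Λ)^{−5/2}·(1+1/d)^{−d/2}·(det A_F(gnoBase p))^{−1/2} ≤ 𝔪(angUnit θ,ε,p)`.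
Proof: ✓`mbDensity_ge_detFol`'s block split (Peter–Paul `θ_PP = 1/d`, followers exact) with the leader-transverse ceiling refined on the soft plane by
✓`fibQ_angUnit_softDir_le` and the rotated-letter Gaussian ✓`lintegral_exp_neg_softRot`. [cite: Breitung1994, Lemma 26] [cite: Luscher1983, §2] -/
theorem mbDensity_ge_softCeil {θ : ℝ} (hθ0 : 0 < θ) (hθ1 : θ ≤ 1) {ε : GnoSign L} (hε : GoodSign ε) (p : ℝ × ℝ) (hp : 0 < p.1 ^ 2 + p.2 ^ 2)
    {AF : GnoCoord L → GnoFol L →ₗ[ℝ] GnoFol L} (hFs : ∀ η, (AF η).IsSymmetric)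
    (hFyy : ∀ η (y : GnoFol L), ⟪AF η y, y⟫_ℝ = iteratedFDeriv ℝ 2 (fun y' : GnoFol L => gnoDeficit z₀ (fun _ => 1) (angUnit θ) ε (η + gnoFolEmb y')) 0 (fun _ => y)) :
    gnoDensity (gnoBase p.1 p.2 : GnoCoord L) * ((2 * ((1 + (finrank ℝ (GnoFol L) : ℝ)) * (122689728 * (L : ℝ) ^ 4 * θ)))⁻¹ *
        (2 * ((1 + (finrank ℝ (GnoFol L) : ℝ)) * (20400 * (L : ℝ) ^ 4))) ^ (-(5 / 2 : ℝ)) *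
        (1 + 1 / (finrank ℝ (GnoFol L) : ℝ)) ^ (-((finrank ℝ (GnoFol L) : ℝ) / 2)) / Real.sqrt (LinearMap.det (AF (gnoBase p.1 p.2)))) ≤
      mbDensity (L := L) (angUnit θ) ε p := by
  -- the hub
  have hπ := Real.pi_gt_three
  have hcos : 0 < Real.cos θ := Real.cos_pos_of_mem_Ioo ⟨by linarith, by linarith⟩
  have hsin : 0 < Real.sin θ := Real.sin_pos_of_pos_of_lt_pi hθ0 (by linarith)
  have hre : (angUnit θ).re ≠ 0 := by rw [angUnit_re]; exact hcos.ne'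
  have him : (angUnit θ).im ≠ 0 := fun h => by
    have h1 := norm_im_angUnit θ
    rw [h, norm_zero, abs_of_pos hsin] at h1
    exact hsin.ne' h1.symm
  have ha : angUnit θ ≠ 0 := angUnit_ne_zero θ
  have hL : (0 : ℝ) < (L : ℝ) := Nat.cast_pos.2 (Nat.pos_of_ne_zero (NeZero.ne L))
  set a : ℍ := angUnit θ with haθ
  set η₀ : GnoCoord L := gnoBase p.1 p.2 with hη₀
  set Λ : ℝ := 20400 * (L : ℝ) ^ 4 with hΛ
  have hΛpos : 0 < Λ := by rw [hΛ]; positivity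
  set Cθ : ℝ := 122689728 * (L : ℝ) ^ 4 * θ with hCθ
  have hCθpos : 0 < Cθ := by rw [hCθ]; positivity
  -- the rotation letters of the base point
  set np : ℝ := Real.sqrt (p.1 ^ 2 + p.2 ^ 2) with hnp
  have hnp0 : 0 < np := Real.sqrt_pos.2 hp
  set c : ℝ := p.1 / np with hc
  set s : ℝ := p.2 / np with hs
  have hcs : c ^ 2 + s ^ 2 = 1 := by
    rw [hc, hs, div_pow, div_pow, ← add_div, hnp, Real.sq_sqrt hp.le, div_self hp.ne']
  -- dimensions (opaque)
  have hd9 := nine_le_finrank_gnoFol (L := L)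
  obtain ⟨d, hd⟩ : ∃ d : ℝ, (finrank ℝ (GnoFol L) : ℝ) = d := ⟨_, rfl⟩
  rw [hd] at hd9 ⊢
  have hdpos : 0 < d := by linarith
  have hdn : (finrank ℝ (GnoFol L) : ℝ) = 3 * (Fintype.card (Fol L) : ℝ) := finrank_gnoFol_real (L := L)
  have hdimL : (finrank ℝ (GnoFibre L) : ℝ) = 7 + d := by
    rw [← hd, hdn]
    have h := card_gnoFibreIdx (L := L)
    rw [finrank_euclideanSpace, h]; push_cast; ring
  -- the fibre Hessian at η₀ and the quadratic form
  obtain ⟨A, hAs, -, hAyy, hAray, hAm, hAbd, -⟩ := exists_gnoFibreHessian z₀ (fun _ => 1) ha ε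
  have hQ : ∀ y : GnoFibre L, fibQ a ε p y = ⟪A η₀ y, y⟫_ℝ := fun y => (hAray η₀ y).symm
  -- coercivity of the fibre form and of the follower block
  set lam : ℝ := min (min (2 * (2 * (‖a‖⁻¹ * a.re) * (‖a‖⁻¹ * ‖a.im‖)) ^ 2 / ((2 + p.1 ^ 2) * (16200 * (L : ℝ) ^ 6)))
        (2 * (‖a‖⁻¹ * ‖a.im‖) ^ 2 / ((2 + p.2 ^ 2) * (16200 * (L : ℝ) ^ 6))))
      (min (1 / (16200 * (L : ℝ) ^ 6)) ((2304 * (L : ℝ) ^ 6 * (Fintype.card (Fol L) : ℝ))⁻¹ / 2)) with hlam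
  have hlampos : 0 < lam := lam_explicit_pos hre him p
  have hcoerA : ∀ y : GnoFibre L, lam * ‖y‖ ^ 2 ≤ ⟪A η₀ y, y⟫_ℝ := fun y => by rw [← hQ]; exact fibQ_coercive_explicit hre him hε p y
  have hfol : ∀ f : GnoFol L, ⟪A η₀ (gnoFolToFibre f), gnoFolToFibre f⟫_ℝ = ⟪AF η₀ f, f⟫_ℝ := fun f =>
    inner_gnoFibreHessian_fol z₀ (fun _ => 1) ha ε hAyy hFyy η₀ f
  have hcoerF : ∀ f : GnoFol L, lam * ‖f‖ ^ 2 ≤ ⟪AF η₀ f, f⟫_ℝ := fun f => by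
    rw [← hfol, ← norm_gnoFolToFibre f]; exact hcoerA _
  have hdetF : 0 < LinearMap.det (AF η₀) := det_pos_of_inner_pos (hFs η₀) (inner_pos_of_coercive hlampos hcoerF)
  -- the bilinear form
  set B : GnoFibre L →ₗ[ℝ] GnoFibre L →ₗ[ℝ] ℝ :=
    LinearMap.mk₂ ℝ (fun v w : GnoFibre L => ⟪A η₀ v, w⟫_ℝ) (fun v v' w => by rw [map_add, inner_add_left]) (fun c v w => by rw [map_smul, real_inner_smul_left, smul_eq_mul])
      (fun v w w' => by rw [inner_add_right]) (fun c v w => by rw [real_inner_smul_right, smul_eq_mul]) with hB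
  have hBapp : ∀ v w : GnoFibre L, B v w = ⟪A η₀ v, w⟫_ℝ := fun v w => rfl
  have hBsym : ∀ v w, B v w = B w v := fun v w => by rw [hBapp, hBapp, hAs η₀ v w]; exact real_inner_comm (A η₀ w) v
  have hBpsd : ∀ v, 0 ≤ B v v := fun v => by rw [hBapp]; exact le_trans (mul_nonneg hlampos.le (sq_nonneg _)) (hcoerA v)
  have hPP : ∀ v w : GnoFibre L, B (v + w) (v + w) ≤ 2 * B v v + 2 * B w w := fun v w => by
    have h0 := hBpsd (v - w)
    simp only [map_add, map_sub, LinearMap.add_apply, LinearMap.sub_apply] at h0 ⊢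
    linarith [hBsym v w]
  -- the block maps
  set E : GnoFibre L ≃ᵐ ((Fin 2 → ℝ) × (Fin 2 → ℝ)) × (Fin 3 → ℝ) × (Fol L → Fin 3 → ℝ) := gnoFibreBlocksEquiv (L := L) with hE
  set ι₁ : ((Fin 2 → ℝ) × (Fin 2 → ℝ)) × (Fin 3 → ℝ) → GnoFibre L := fun ℓ => E.symm (ℓ.1, (ℓ.2, (0 : Fol L → Fin 3 → ℝ))) with hι₁
  set ι₂ : (Fol L → Fin 3 → ℝ) → GnoFibre L := fun F => E.symm (((0 : Fin 2 → ℝ), (0 : Fin 2 → ℝ)), ((0 : Fin 3 → ℝ), F)) with hι₂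
  have hEadd : ∀ y y' : GnoFibre L, E (y + y') = E y + E y' := fun y y' => by
    show gnoFibreBlocks (y + y') = gnoFibreBlocks y + gnoFibreBlocks y'
    rfl
  have hdecomp : ∀ (ℓ : ((Fin 2 → ℝ) × (Fin 2 → ℝ)) × (Fin 3 → ℝ)) (F : Fol L → Fin 3 → ℝ), E.symm (ℓ.1, (ℓ.2, F)) = ι₁ ℓ + ι₂ F := fun ℓ F => by
    apply E.injective
    rw [hEadd, hι₁, hι₂, E.apply_symm_apply, E.apply_symm_apply, E.apply_symm_apply]
    simp
  have hι₁add : ∀ ℓ ℓ' : ((Fin 2 → ℝ) × (Fin 2 → ℝ)) × (Fin 3 → ℝ), ι₁ (ℓ + ℓ') = ι₁ ℓ + ι₁ ℓ' := fun ℓ ℓ' => by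
    apply E.injective
    rw [hEadd, hι₁, E.apply_symm_apply, E.apply_symm_apply, E.apply_symm_apply]
    simp
  have hι₂fol : ∀ f : GnoFol L, ι₂ (gnoFolBlocksEquiv f) = gnoFolToFibre f := fun f => by
    rw [hι₂]
    apply E.injective
    rw [E.apply_symm_apply, hE, gnoFibreBlocksEquiv_apply, gnoFibreBlocks_gnoFolToFibre, gnoFolBlocksEquiv_apply]
  have hblocks₁ : ∀ ℓ : ((Fin 2 → ℝ) × (Fin 2 → ℝ)) × (Fin 3 → ℝ), gnoFibreBlocks (ι₁ ℓ) = (ℓ.1, (ℓ.2, (0 : Fol L → Fin 3 → ℝ))) := fun ℓ => by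
    rw [← gnoFibreBlocksEquiv_apply, ← hE, hι₁, E.apply_symm_apply]
  -- norm of the leader-transverse block
  have hnorm₁ : ∀ ℓ : ((Fin 2 → ℝ) × (Fin 2 → ℝ)) × (Fin 3 → ℝ), ‖ι₁ ℓ‖ ^ 2 = (∑ i, ℓ.1.1 i ^ 2) + (∑ i, ℓ.1.2 i ^ 2) + ∑ i, ℓ.2 i ^ 2 := fun ℓ => by
    have h := norm_sq_gnoFibre (ι₁ ℓ)
    rw [hblocks₁ ℓ] at h
    simp only [Fin.sum_univ_two, Fin.sum_univ_three, normSq3, Pi.zero_apply] at h ⊢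
    rw [h]
    simp [Finset.sum_const_zero]
  -- §A the block inequality (LEAD): θ_PP = 1/d, c = 1/2
  have hθd : 0 < 1 / d := by positivity
  have hmeasB : Measurable fun y : GnoFibre L => B y y := by
    have e : (fun y : GnoFibre L => B y y) = fun y => fibQ a ε p y := funext fun y => by rw [hBapp, hQ]
    rw [e]; exact measurable_fibQ ha ε p
  have hmι₁ : Measurable ι₁ := E.symm.measurable.comp (measurable_fst.prodMk (measurable_snd.prodMk measurable_const))
  have hmι₂ : Measurable ι₂ := E.symm.measurable.comp (measurable_const.prodMk (measurable_const.prodMk measurable_id))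
  have hblock := lintegral_prod_gaussian_block_ge (volume : Measure (((Fin 2 → ℝ) × (Fin 2 → ℝ)) × (Fin 3 → ℝ))) (volume : Measure (Fol L → Fin 3 → ℝ))
    B hBsym hBpsd hθd (by norm_num : (0 : ℝ) ≤ 1 / 2) ι₁ ι₂ (hmeasB.comp hmι₁).aemeasurable (hmeasB.comp hmι₂).aemeasurable
  -- §B the right side is ∫_{V_L} e^{−½Q}
  have hRHS : ∫⁻ q : (((Fin 2 → ℝ) × (Fin 2 → ℝ)) × (Fin 3 → ℝ)) × (Fol L → Fin 3 → ℝ), ENNReal.ofReal (Real.exp (-(1 / 2 * B (ι₁ q.1 + ι₂ q.2) (ι₁ q.1 + ι₂ q.2))))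
      ∂((volume : Measure (((Fin 2 → ℝ) × (Fin 2 → ℝ)) × (Fin 3 → ℝ))).prod (volume : Measure (Fol L → Fin 3 → ℝ))) =
      ∫⁻ y : GnoFibre L, ENNReal.ofReal (Real.exp (-(fibQ a ε p y / 2))) := by
    have hG : Measurable fun y : GnoFibre L => ENNReal.ofReal (Real.exp (-(fibQ a ε p y / 2))) :=
      ENNReal.measurable_ofReal.comp (Real.measurable_exp.comp ((measurable_fibQ ha ε p).div_const 2).neg)
    have h1 : ∫⁻ y : GnoFibre L, ENNReal.ofReal (Real.exp (-(fibQ a ε p y / 2))) =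
        ∫⁻ b, ENNReal.ofReal (Real.exp (-(fibQ a ε p (E.symm b) / 2))) ∂(volume : Measure (((Fin 2 → ℝ) × (Fin 2 → ℝ)) × (Fin 3 → ℝ) × (Fol L → Fin 3 → ℝ))) := by
      rw [← (volume_preserving_gnoFibreBlocksEquiv (L := L)).symm.lintegral_comp_emb E.symm.measurableEmbedding]
    have h2 : (volume : Measure (((Fin 2 → ℝ) × (Fin 2 → ℝ)) × (Fin 3 → ℝ) × (Fol L → Fin 3 → ℝ))) =
        Measure.map MeasurableEquiv.prodAssoc (((volume : Measure ((Fin 2 → ℝ) × (Fin 2 → ℝ))).prod (volume : Measure (Fin 3 → ℝ))).prod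
          (volume : Measure (Fol L → Fin 3 → ℝ))) := by
      rw [Measure.prodAssoc_prod]; rfl
    have hG' : Measurable fun b : ((Fin 2 → ℝ) × (Fin 2 → ℝ)) × (Fin 3 → ℝ) × (Fol L → Fin 3 → ℝ) => ENNReal.ofReal (Real.exp (-(fibQ a ε p (E.symm b) / 2))) :=
      hG.comp E.symm.measurable
    rw [h1, h2, lintegral_map hG' MeasurableEquiv.prodAssoc.measurable]
    refine lintegral_congr fun q => ?_
    simp only [MeasurableEquiv.prodAssoc, MeasurableEquiv.coe_mk, Equiv.prodAssoc_apply]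
    rw [hdecomp (q.1.1, q.1.2) q.2, hBapp, ← hQ]
    ring_nf
  -- §C the follower factor
  have hfolInt : ∫⁻ F : Fol L → Fin 3 → ℝ, ENNReal.ofReal (Real.exp (-(1 / 2 * ((1 + 1 / d) * B (ι₂ F) (ι₂ F))))) =
      ENNReal.ofReal ((2 * Real.pi / (1 + 1 / d)) ^ (d / 2) / Real.sqrt (LinearMap.det (AF η₀))) := by
    have hs1 : 0 < 1 + 1 / d := by positivity
    have h1 : ∫⁻ F : Fol L → Fin 3 → ℝ, ENNReal.ofReal (Real.exp (-(1 / 2 * ((1 + 1 / d) * B (ι₂ F) (ι₂ F))))) =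
        ∫⁻ f : GnoFol L, ENNReal.ofReal (Real.exp (-((1 + 1 / d) * ((1 / 2) * ⟪AF η₀ f, f⟫_ℝ)))) := by
      have hm : Measurable fun F : Fol L → Fin 3 → ℝ => ENNReal.ofReal (Real.exp (-(1 / 2 * ((1 + 1 / d) * B (ι₂ F) (ι₂ F))))) :=
        ENNReal.measurable_ofReal.comp (Real.measurable_exp.comp (((hmeasB.comp hmι₂).const_mul _).const_mul _).neg)
      rw [← (volume_preserving_gnoFolBlocksEquiv (L := L)).lintegral_comp hm]
      refine lintegral_congr fun f => ?_
      rw [hι₂fol, hBapp, hfol]; ring_nf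
    rw [h1, ← ofReal_integral_eq_lintegral_ofReal (integrable_exp_neg_mul_half_inner hlampos hcoerF hs1) (ae_of_all _ fun f => (Real.exp_pos _).le),
      integral_exp_neg_mul_half_inner (hFs η₀) hlampos hcoerF hs1, hd]
  -- §D the leader-transverse factor WITH ONE SOFT PAIR
  have hd1 : 0 ≤ 1 + d := by linarith
  have hA₁ : 0 < (1 + d) * Cθ := by positivity
  have hA₂ : 0 < (1 + d) * Λ := by positivity
  -- the pointwise ceiling in rotated letters
  have hceil : ∀ ℓ : ((Fin 2 → ℝ) × (Fin 2 → ℝ)) × (Fin 3 → ℝ),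
      1 / 2 * ((1 + d) * B (ι₁ ℓ) (ι₁ ℓ)) ≤
        ((1 + d) * Cθ * ∑ i, (c • ℓ.1.1 + s • ℓ.1.2) i ^ 2 + (1 + d) * Λ * ∑ i, (s • ℓ.1.1 - c • ℓ.1.2) i ^ 2) + (1 + d) * Λ * ∑ i, ℓ.2 i ^ 2 := by
    intro ℓ
    set σ : Fin 2 → ℝ := c • ℓ.1.1 + s • ℓ.1.2 with hσ
    set ηv : Fin 2 → ℝ := s • ℓ.1.1 - c • ℓ.1.2 with hηv
    set ys : GnoFibre L := ι₁ (((c • σ), (s • σ)), (0 : Fin 3 → ℝ)) with hys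
    set yr : GnoFibre L := ι₁ (((s • ηv), (-(c • ηv))), ℓ.2) with hyr
    -- the split
    have hsplit : ι₁ ℓ = ys + yr := by
      rw [hys, hyr, ← hι₁add]
      congr 1
      have hq := softRot_softRot hcs ℓ.1
      refine Prod.ext (Prod.ext ?_ ?_) ?_
      · simp only [Prod.fst_add]; exact (congrArg Prod.fst hq).symm
      · simp only [Prod.fst_add, Prod.snd_add, ← sub_eq_add_neg]; exact (congrArg Prod.snd hq).symm
      · simp only [Prod.snd_add, zero_add]
    -- norms
    have hsum_smul : ∀ (k : ℝ) (w : Fin 2 → ℝ), ∑ i, (k • w) i ^ 2 = k ^ 2 * ∑ i, w i ^ 2 := fun k w => by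
      simp only [Pi.smul_apply, smul_eq_mul, mul_pow, Finset.mul_sum]
    have hns : ‖ys‖ ^ 2 = ∑ i, σ i ^ 2 := by
      rw [hys, hnorm₁]
      simp only [hsum_smul, Pi.zero_apply]
      simp only [ne_eq, OfNat.ofNat_ne_zero, not_false_eq_true, zero_pow, Finset.sum_const_zero, add_zero]
      linear_combination (∑ i, σ i ^ 2) * hcs
    have hnr : ‖yr‖ ^ 2 = (∑ i, ηv i ^ 2) + ∑ i, ℓ.2 i ^ 2 := by
      rw [hyr, hnorm₁]
      have e : ∑ i, (-(c • ηv)) i ^ 2 = c ^ 2 * ∑ i, ηv i ^ 2 := by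
        simp only [Pi.neg_apply, Pi.smul_apply, smul_eq_mul, neg_sq, mul_pow, Finset.mul_sum]
      simp only [hsum_smul, e]
      linear_combination (∑ i, ηv i ^ 2) * hcs
    -- the soft ceiling and the isotropic ceiling
    have hyblocks : gnoFibreBlocks ys = (((p.1 • (np⁻¹ • σ)), (p.2 • (np⁻¹ • σ))), ((0 : Fin 3 → ℝ), (0 : Fol L → Fin 3 → ℝ))) := by
      rw [hys, hblocks₁, smul_smul, smul_smul, ← div_eq_mul_inv, ← div_eq_mul_inv]
    have hsoft : B ys ys ≤ Cθ * ∑ i, σ i ^ 2 := by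
      rw [hBapp, ← hQ, ← hns, hCθ]
      have h := fibQ_angUnit_softDir_le (L := L) hsin.le ε hε.1 hε.2 p (np⁻¹ • σ) ys hyblocks
      rwa [abs_of_pos hθ0] at h
    have hrest : B yr yr ≤ Λ * ((∑ i, ηv i ^ 2) + ∑ i, ℓ.2 i ^ 2) := by
      rw [hBapp, ← hnr, hΛ]
      exact (abs_le.1 (hAbd η₀ yr)).2
    have hpp := hPP ys yr
    rw [← hsplit] at hpp
    have hσnn : 0 ≤ ∑ i, σ i ^ 2 := Finset.sum_nonneg fun i _ => sq_nonneg _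
    have hηnn : 0 ≤ (∑ i, ηv i ^ 2) + ∑ i, ℓ.2 i ^ 2 := add_nonneg (Finset.sum_nonneg fun i _ => sq_nonneg _) (Finset.sum_nonneg fun i _ => sq_nonneg _)
    nlinarith [hpp, hsoft, hrest, hd1, mul_nonneg hd1 (sub_nonneg.2 hsoft), mul_nonneg hd1 (sub_nonneg.2 hrest), mul_nonneg hd1 (sub_nonneg.2 hpp)]
  have hleadInt : ENNReal.ofReal ((Real.sqrt (Real.pi / ((1 + d) * Cθ)) ^ 2 * Real.sqrt (Real.pi / ((1 + d) * Λ)) ^ 2) * Real.sqrt (Real.pi / ((1 + d) * Λ)) ^ 3) ≤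
      ∫⁻ ℓ : ((Fin 2 → ℝ) × (Fin 2 → ℝ)) × (Fin 3 → ℝ), ENNReal.ofReal (Real.exp (-(1 / 2 * ((1 + d) * B (ι₁ ℓ) (ι₁ ℓ))))) := by
    -- the factorised minorant
    have hmin : ∀ ℓ : ((Fin 2 → ℝ) × (Fin 2 → ℝ)) × (Fin 3 → ℝ),
        ENNReal.ofReal (Real.exp (-((1 + d) * Cθ * ∑ i, (c • ℓ.1.1 + s • ℓ.1.2) i ^ 2 + (1 + d) * Λ * ∑ i, (s • ℓ.1.1 - c • ℓ.1.2) i ^ 2))) *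
            ENNReal.ofReal (Real.exp (-((1 + d) * Λ * ∑ i, ℓ.2 i ^ 2))) ≤
          ENNReal.ofReal (Real.exp (-(1 / 2 * ((1 + d) * B (ι₁ ℓ) (ι₁ ℓ))))) := fun ℓ => by
      rw [← ENNReal.ofReal_mul (Real.exp_pos _).le, ← Real.exp_add]
      exact ENNReal.ofReal_le_ofReal (Real.exp_le_exp.2 (by linarith [hceil ℓ]))
    refine le_trans (le_of_eq ?_) (lintegral_mono hmin)
    -- the product integral
    have hS : Measurable fun w : Fin 2 → ℝ => ∑ i, w i ^ 2 := Finset.measurable_sum _ fun i _ => (measurable_pi_apply i).pow_const 2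
    have hT : Measurable fun q : (Fin 2 → ℝ) × (Fin 2 → ℝ) => (c • q.1 + s • q.2, s • q.1 - c • q.2) := (measurePreserving_softRot hcs).measurable
    have hm1 : Measurable fun q : (Fin 2 → ℝ) × (Fin 2 → ℝ) =>
        ENNReal.ofReal (Real.exp (-((1 + d) * Cθ * ∑ i, (c • q.1 + s • q.2) i ^ 2 + (1 + d) * Λ * ∑ i, (s • q.1 - c • q.2) i ^ 2))) :=
      ENNReal.measurable_ofReal.comp (Real.measurable_exp.comp
        (((hS.comp (measurable_fst.comp hT)).const_mul _).add ((hS.comp (measurable_snd.comp hT)).const_mul _)).neg)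
    have hm2 : Measurable fun z : Fin 3 → ℝ => ENNReal.ofReal (Real.exp (-((1 + d) * Λ * ∑ i, z i ^ 2))) :=
      ENNReal.measurable_ofReal.comp (Real.measurable_exp.comp ((Finset.measurable_sum _ fun i _ => (measurable_pi_apply i).pow_const 2).const_mul _).neg)
    rw [MeasureTheory.Measure.volume_eq_prod, lintegral_prod_mul hm1.aemeasurable hm2.aemeasurable]
    have hz : ∫⁻ z : Fin 3 → ℝ, ENNReal.ofReal (Real.exp (-((1 + d) * Λ * ∑ i, z i ^ 2))) = ENNReal.ofReal (Real.sqrt (Real.pi / ((1 + d) * Λ)) ^ 3) := by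
      rw [← integral_exp_neg_mul_sumSq_pi 3, ofReal_integral_eq_lintegral_ofReal (integrable_exp_neg_mul_sumSq_pi 3 hA₂) (ae_of_all _ fun q => (Real.exp_pos _).le)]
    have huv := lintegral_exp_neg_softRot hcs hA₁ hA₂
    rw [huv, hz, ← ENNReal.ofReal_mul (by positivity)]
  -- §E assemble in `ℝ≥0∞`, then in `ℝ`
  have hchain : ENNReal.ofReal ((Real.sqrt (Real.pi / ((1 + d) * Cθ)) ^ 2 * Real.sqrt (Real.pi / ((1 + d) * Λ)) ^ 2) * Real.sqrt (Real.pi / ((1 + d) * Λ)) ^ 3) *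
        ENNReal.ofReal ((2 * Real.pi / (1 + 1 / d)) ^ (d / 2) / Real.sqrt (LinearMap.det (AF η₀))) ≤
      ∫⁻ y : GnoFibre L, ENNReal.ofReal (Real.exp (-(fibQ a ε p y / 2))) := by
    rw [← hRHS, ← hfolInt]
    have hθinv : (1 / d)⁻¹ = d := by rw [one_div, inv_inv]
    rw [hθinv] at hblock
    exact le_trans (mul_le_mul' hleadInt le_rfl) hblock
  -- back to real integrals
  have hint := integrable_exp_neg_fibQ_half hre him hε p
  rw [← ofReal_integral_eq_lintegral_ofReal hint (ae_of_all _ fun y => (Real.exp_pos _).le), ← ENNReal.ofReal_mul (by positivity)] at hchain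
  have hIpos : 0 ≤ ∫ y : GnoFibre L, Real.exp (-(fibQ a ε p y / 2)) := integral_nonneg fun y => (Real.exp_pos _).le
  have hreal := (ENNReal.ofReal_le_ofReal_iff hIpos).1 hchain
  -- the leader factor in `2π` letters
  have hlead : (Real.sqrt (Real.pi / ((1 + d) * Cθ)) ^ 2 * Real.sqrt (Real.pi / ((1 + d) * Λ)) ^ 2) * Real.sqrt (Real.pi / ((1 + d) * Λ)) ^ 3 =
      (2 * Real.pi) ^ ((7 : ℝ) / 2) * ((2 * ((1 + d) * Cθ))⁻¹ * (2 * ((1 + d) * Λ)) ^ (-(5 / 2 : ℝ))) := by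
    have h1 : Real.sqrt (Real.pi / ((1 + d) * Cθ)) ^ 2 = (2 * Real.pi) * (2 * ((1 + d) * Cθ))⁻¹ := by
      rw [Real.sq_sqrt (by positivity)]; field_simp
    have h2 : Real.sqrt (Real.pi / ((1 + d) * Λ)) ^ 2 * Real.sqrt (Real.pi / ((1 + d) * Λ)) ^ 3 = (2 * Real.pi) ^ ((5 : ℝ) / 2) * (2 * ((1 + d) * Λ)) ^ (-(5 / 2 : ℝ)) := by
      have hx : 0 < 2 * ((1 + d) * Λ) := by positivity
      rw [← pow_add, show (2 + 3 : ℕ) = 5 by norm_num,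
        show Real.pi / ((1 + d) * Λ) = 2 * Real.pi / (2 * ((1 + d) * Λ)) by field_simp, Real.sqrt_eq_rpow, ← Real.rpow_natCast,
        ← Real.rpow_mul (by positivity), Real.div_rpow (by positivity) hx.le, Real.rpow_neg hx.le, div_eq_mul_inv]
      norm_num
    have h3 : (2 * Real.pi) ^ ((7 : ℝ) / 2) = (2 * Real.pi) * (2 * Real.pi) ^ ((5 : ℝ) / 2) := by
      rw [show ((7 : ℝ) / 2) = 1 + (5 : ℝ) / 2 by norm_num, Real.rpow_add (by positivity), Real.rpow_one]
    rw [mul_assoc, h2, h1, h3]; ring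
  rw [hlead] at hreal
  -- the normalisation `(2π)^{−α}`, `α = (7 + d)/2`
  unfold mbDensity alpha
  rw [hdimL]
  have hρ : 0 ≤ gnoDensity (gnoBase p.1 p.2 : GnoCoord L) := (gnoDensity_pos _).le
  rw [mul_assoc (gnoDensity (gnoBase p.1 p.2 : GnoCoord L))]
  refine mul_le_mul_of_nonneg_left ?_ hρ
  have hpow : (2 * Real.pi / (1 + 1 / d)) ^ (d / 2) = (2 * Real.pi) ^ (d / 2) * (1 + 1 / d) ^ (-(d / 2)) := by
    rw [Real.div_rpow (by positivity) (by positivity), Real.rpow_neg (by positivity), div_eq_mul_inv]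
  have h2pi : (2 * Real.pi) ^ ((7 + d) / 2) = (2 * Real.pi) ^ ((7 : ℝ) / 2) * (2 * Real.pi) ^ (d / 2) := by
    rw [← Real.rpow_add (by positivity)]; ring_nf
  rw [hpow] at hreal
  have h2pipos : 0 < (2 * Real.pi) ^ ((7 + d) / 2) := by positivity
  rw [le_inv_mul_iff₀ h2pipos, h2pi]
  calc (2 * Real.pi) ^ ((7 : ℝ) / 2) * (2 * Real.pi) ^ (d / 2) *
        ((2 * ((1 + d) * Cθ))⁻¹ * (2 * ((1 + d) * Λ)) ^ (-(5 / 2 : ℝ)) * (1 + 1 / d) ^ (-(d / 2)) / Real.sqrt (LinearMap.det (AF η₀)))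
      = (2 * Real.pi) ^ ((7 : ℝ) / 2) * ((2 * ((1 + d) * Cθ))⁻¹ * (2 * ((1 + d) * Λ)) ^ (-(5 / 2 : ℝ))) *
          ((2 * Real.pi) ^ (d / 2) * (1 + 1 / d) ^ (-(d / 2)) / Real.sqrt (LinearMap.det (AF η₀))) := by ring
    _ ≤ ∫ y : GnoFibre L, Real.exp (-(fibQ a ε p y / 2)) := hreal

/-- ★★ **The same with the absolute constant `e^{−1∕2}`** (LEAD's ✓`exp_neg_half_le_one_add_inv_rpow`: `e^{−1∕2} ≤ (1 + 1∕d)^{−d∕2}`):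
`gnoDensity(gnoBase p)·(2(1+d)Cθ)^{−1}·(2(1+d)Λ)^{−5/2}·e^{−1∕2}·(det A_F(gnoBase p))^{−1∕2} ≤ 𝔪(angUnit θ,ε,p)`. [cite: Breitung1994, Lemma 26] -/
theorem mbDensity_ge_softCeil' {θ : ℝ} (hθ0 : 0 < θ) (hθ1 : θ ≤ 1) {ε : GnoSign L} (hε : GoodSign ε) (p : ℝ × ℝ) (hp : 0 < p.1 ^ 2 + p.2 ^ 2)
    {AF : GnoCoord L → GnoFol L →ₗ[ℝ] GnoFol L} (hFs : ∀ η, (AF η).IsSymmetric)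
    (hFyy : ∀ η (y : GnoFol L), ⟪AF η y, y⟫_ℝ = iteratedFDeriv ℝ 2 (fun y' : GnoFol L => gnoDeficit z₀ (fun _ => 1) (angUnit θ) ε (η + gnoFolEmb y')) 0 (fun _ => y)) :
    gnoDensity (gnoBase p.1 p.2 : GnoCoord L) * ((2 * ((1 + (finrank ℝ (GnoFol L) : ℝ)) * (122689728 * (L : ℝ) ^ 4 * θ)))⁻¹ *
        (2 * ((1 + (finrank ℝ (GnoFol L) : ℝ)) * (20400 * (L : ℝ) ^ 4))) ^ (-(5 / 2 : ℝ)) *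
        Real.exp (-(1 / 2 : ℝ)) / Real.sqrt (LinearMap.det (AF (gnoBase p.1 p.2)))) ≤
      mbDensity (L := L) (angUnit θ) ε p := by
  refine le_trans ?_ (mbDensity_ge_softCeil hθ0 hθ1 hε p hp hFs hFyy)
  have hρ : 0 ≤ gnoDensity (gnoBase p.1 p.2 : GnoCoord L) := (gnoDensity_pos _).le
  have hL : (0 : ℝ) < (L : ℝ) := Nat.cast_pos.2 (Nat.pos_of_ne_zero (NeZero.ne L))
  have hd9 := nine_le_finrank_gnoFol (L := L)
  have hd0 : 0 ≤ 1 + (finrank ℝ (GnoFol L) : ℝ) := by linarith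
  refine mul_le_mul_of_nonneg_left (div_le_div_of_nonneg_right (mul_le_mul_of_nonneg_left ?_ ?_) (Real.sqrt_nonneg _)) hρ
  · exact exp_neg_half_le_one_add_inv_rpow (finrank ℝ (GnoFol L))
  · exact mul_nonneg (inv_nonneg.2 (by positivity)) (Real.rpow_nonneg (by positivity) _)

end Summit.QuantumFields.YangMills.Theorems.SwapVirialDeficit.SectorLaplace

end
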